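import Mathlib.Topology.Algebra.Group.ClosedSubgroup
import Mathlib.Topology.Algebra.Group.Quotient
import Mathlib.Algebra.Group.Subgroup.Pointwise
import Mathlib.Tactic.Group
import Literature.AnabelianGeometry.SemiGraphs.ArithMaximalCompact
import HarnessLib

/-!
# [SemiAnbd] Theorem 5.4 (iii), clause 1: openness transfer for the induced homomorphism
# (sub-DAG SemiAnbd-Thm54, row T54-5; proof-only over the data of `ArithMaximalCompact.lean`)

Mochizuki, *Semi-graphs of anabelioids*, Publ. RIMS **42** (2006), §5, Theorem 5.4 (iii), author's
manuscript p. 66 [cite: MochizukiSemiAnbd2006, Thm 5.4 (iii), p. 66]: the morphism of temperoids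
`B^temp(𝔊) → B^temp(ℍ)` induced by a locally open morphism `𝔊 → ℍ` over `A` is *arithmetically
quasi-geometric*, i.e. (in the shape consumed by `isArithQuasiGeometric_of_statementII`, seat
abc-iut-w4-d085) it maps every verticial (resp. edge-like) subgroup of `Π^temp_𝔊` onto an OPEN subgroup
of a verticial (resp. edge-like) subgroup of `Π^temp_ℍ`.  Printed proof: "entirely parallel to the
proofs of Theorem 3.7, Corollary 3.9" (p. 66).

This PROOF-ONLY file (no `def … : Prop`, nothing asserted) isolates and PROVES the one non-definitional
step of that parallel at the level of the data `(D, aug)` of p. 65 (`DecompositionData`, the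
augmentation `aug : Π^temp_𝔊 → Π_A`): **openness passes from the geometric parts to the arithmetic
decomposition groups**.  Precisely (`mapsOntoOpen_of_geomOpen`): if a continuous `φ` over `Π_A`
(`aug' ∘ φ = aug`) maps a compact, arithmetically ample `K ≤ Π^temp_𝔊` into a compact `M ≤ Π^temp_ℍ` and
maps the geometric part `K ∩ Ker(aug)` onto an open subgroup of `M ∩ Ker(aug')` (this is where §3 —
Thm 3.7 (iv), Cor 3.9 — enters, cf. Rmk 5.3.1), then `φ(K)` is open in `M`: `φ(K)` is closed (compact),
`S := M ∩ aug'⁻¹(aug K)` is open in the compact group `M` hence of finite index, and `S/φ(K)` is a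
quotient of the finite set `(M ∩ Ker aug')/(φ(K) ∩ Ker aug')` (the latter subgroup is open in the
compact group `M ∩ Ker aug'`); a closed subgroup of finite index is open (Mathlib
`Subgroup.isOpen_of_isClosed_of_finiteIndex`).  Only `Π_A` Hausdorff-`T₁` is used, not its compactness.
`hV_of_compat` / `hE_of_compat` transport this from chosen
representatives to ALL verticial / edge-like subgroups (they are conjugates of the representatives),
yielding exactly the hypotheses `hV`, `hE` of `isArithQuasiGeometric_of_statementII` from: Remark
5.3.1 first sentence on both sides (`VerticialEdgeLikeCompactAmpleStatement`, row T54-1, consumed BY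
NAME as hypotheses) and, per vertex / branch, the containment-up-to-conjugacy of the arithmetic
decomposition groups together with geometric openness inside (INPUTS: properties of the induced
homomorphism which its constructor — row T54-0 / Prop 5.2 (iv) — supplies; not asserted here).
Nothing here bears on [IUTchIII] Cor. 3.12; no side is taken.
-/

namespace Literature.AnabelianGeometry.SemiGraphs

open scoped Pointwise

universe u u' u'' w w'

/-! ### Two lemmas of topological / abstract group theory -/

namespace ArithOpenness

/-- An open subgroup of a compact topological group has finite index (the quotient is compact and
discrete). [cite: MochizukiSemiAnbd2006, Thm 5.4 (iii), p. 66] -/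
theorem finiteIndex_of_isOpen_of_compactSpace {G : Type*} [Group G] [TopologicalSpace G]
    [IsTopologicalGroup G] [CompactSpace G] (H : Subgroup G) (hH : IsOpen (H : Set G)) :
    H.FiniteIndex := by
  haveI : DiscreteTopology (G ⧸ H) := QuotientGroup.discreteTopology_iff.mpr hH
  haveI : Finite (G ⧸ H) := finite_of_compact_of_discrete
  exact Subgroup.finiteIndex_of_finite_quotient

/-- Index bookkeeping behind "`S/φ(K)` is a quotient of `N/(φ(K) ∩ N)`": if `L, N ≤ S` are subgroups
with `S ⊆ N · L` and `L ∩ N` has finite index in `N`, then `L` has finite index in `S`.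
[cite: MochizukiSemiAnbd2006, Thm 5.4 (iii), p. 66] -/
theorem relIndex_ne_zero_of_subset_mul {G : Type*} [Group G] {L N S : Subgroup G}
    (hNS : N ≤ S) (hS : ∀ s ∈ S, ∃ n ∈ N, ∃ l ∈ L, s = n * l) (hLN : L.relIndex N ≠ 0) :
    L.relIndex S ≠ 0 := by
  haveI : (L.subgroupOf N).FiniteIndex := ⟨hLN⟩
  haveI : Finite (N ⧸ L.subgroupOf N) := Subgroup.finite_quotient_of_finiteIndex
  let ψ : N ⧸ L.subgroupOf N → S ⧸ L.subgroupOf S :=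
    Quotient.map' (Subgroup.inclusion hNS) (by
      intro a b hab
      rw [QuotientGroup.leftRel_apply] at hab ⊢
      simpa [Subgroup.mem_subgroupOf] using hab)
  have hψ : Function.Surjective ψ := by
    rintro ⟨s⟩
    obtain ⟨n, hn, l, hl, hs⟩ := hS s.1 s.2
    refine ⟨QuotientGroup.mk ⟨n, hn⟩, ?_⟩
    change ψ (Quotient.mk'' _) = Quotient.mk'' _
    simp only [ψ, Quotient.map'_mk'']
    change (QuotientGroup.mk (Subgroup.inclusion hNS ⟨n, hn⟩) : S ⧸ L.subgroupOf S) = QuotientGroup.mk s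
    rw [QuotientGroup.eq, Subgroup.mem_subgroupOf]
    change ((n : G)⁻¹ * (s : G)) ∈ L
    rw [hs, inv_mul_cancel_left]
    exact hl
  haveI : Finite (S ⧸ L.subgroupOf S) := Finite.of_surjective ψ hψ
  exact (Subgroup.finiteIndex_of_finite_quotient (H := L.subgroupOf S)).index_ne_zero

end ArithOpenness

/-! ### The openness transfer -/

section Transfer

variable {Gtp : Type u} [Group Gtp] [TopologicalSpace Gtp]
variable {Htp : Type u''} [Group Htp] [TopologicalSpace Htp] [IsTopologicalGroup Htp] [T2Space Htp]
variable {PA : Type u'} [Group PA] [TopologicalSpace PA] [T1Space PA]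

/-- **Openness transfer** (the step of Thm 5.4 (iii), clause 1, that is not a substitution of
definitions; p. 66 "entirely parallel to … Corollary 3.9"): let `φ : Π^temp_𝔊 → Π^temp_ℍ` be continuous
over `Π_A` (`aug' ∘ φ = aug`), `K ≤ Π^temp_𝔊` compact and arithmetically ample, `M ≤ Π^temp_ℍ` compact with
`φ(K) ≤ M`, and suppose `φ` maps the geometric part `K ∩ Ker aug` onto an open subgroup of
`M ∩ Ker aug'`.  Then `φ` maps `K` onto an open subgroup of `M`. [cite: MochizukiSemiAnbd2006, Thm 5.4 (iii), p. 66] -/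
theorem mapsOntoOpen_of_geomOpen {aug : Gtp →* PA} {aug' : Htp →* PA} (haug' : Continuous aug')
    {φ : Gtp →* Htp} (hφ : Continuous φ) (hcomp : aug'.comp φ = aug)
    {K : Subgroup Gtp} {M : Subgroup Htp} (hK : IsCompact (K : Set Gtp))
    (hM : IsCompact (M : Set Htp)) (hle : K.map φ ≤ M) (hKa : IsArithAmple aug K)
    (hgeom : MapsOntoOpenSubgroupOf φ (K ⊓ aug.ker) (M ⊓ aug'.ker)) :
    MapsOntoOpenSubgroupOf φ K M := by
  classical
  refine ⟨hle, ?_⟩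
  -- the subgroups of the argument
  set L : Subgroup Htp := K.map φ with hLdef
  let N : Subgroup Htp := M ⊓ aug'.ker
  let S : Subgroup Htp := M ⊓ (K.map aug).comap aug'
  have hLS : L ≤ S := by
    refine le_inf hle ?_
    rintro _ ⟨k, hk, rfl⟩
    refine Subgroup.mem_comap.mpr ⟨k, hk, ?_⟩
    change aug k = aug' (φ k)
    rw [← hcomp]
    rfl
  have hNS : N ≤ S := by
    refine inf_le_inf_left M ?_
    intro x hx
    rw [MonoidHom.mem_ker] at hx
    exact Subgroup.mem_comap.mpr (by rw [hx]; exact one_mem _)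
  have hSM : S ≤ M := inf_le_left
  -- `S ⊆ N · L`
  have hS : ∀ s ∈ S, ∃ n ∈ N, ∃ l ∈ L, s = n * l := by
    intro s hs
    obtain ⟨hsM, hs'⟩ := Subgroup.mem_inf.mp hs
    obtain ⟨k, hk, hks⟩ := Subgroup.mem_comap.mp hs'
    refine ⟨s * (φ k)⁻¹, Subgroup.mem_inf.mpr ⟨M.mul_mem hsM (M.inv_mem (hle ⟨k, hk, rfl⟩)), ?_⟩,
      φ k, ⟨k, hk, rfl⟩, by rw [inv_mul_cancel_right]⟩
    rw [MonoidHom.mem_ker, map_mul, map_inv, ← hks]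
    change aug k * (aug'.comp φ k)⁻¹ = 1
    rw [hcomp, mul_inv_cancel]
  -- compactness / closedness
  haveI : CompactSpace M := isCompact_iff_compactSpace.mp hM
  have hMcl : IsClosed (M : Set Htp) := hM.isClosed
  have hLcpt : IsCompact (L : Set Htp) := by
    rw [hLdef, Subgroup.coe_map]
    exact hK.image hφ
  have hNcl : IsClosed (N : Set Htp) := by
    change IsClosed ((M : Set Htp) ∩ (aug'.ker : Set Htp))
    refine hMcl.inter ?_
    rw [MonoidHom.coe_ker]
    exact isClosed_singleton.preimage haug'
  have hNcpt : IsCompact (N : Set Htp) := hM.of_isClosed_subset hNcl inf_le_left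
  -- (1) `S` has finite index in `M`: it is open in the compact group `M`
  have hSM' : S.relIndex M ≠ 0 := by
    have hopen : IsOpen ((S.subgroupOf M : Subgroup M) : Set M) := by
      rw [Subgroup.coe_subgroupOf]
      have : (M.subtype ⁻¹' (S : Set Htp)) = (fun x : M => aug' (x : Htp)) ⁻¹' (K.map aug : Set PA) := by
        ext x
        simp only [Set.mem_preimage, SetLike.mem_coe, Subgroup.coe_subtype]
        constructor
        · intro hx
          exact Subgroup.mem_comap.mp (Subgroup.mem_inf.mp hx).2
        · intro hx
          exact Subgroup.mem_inf.mpr ⟨x.2, Subgroup.mem_comap.mpr hx⟩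
      rw [this]
      exact hKa.preimage (haug'.comp continuous_subtype_val)
    exact (ArithOpenness.finiteIndex_of_isOpen_of_compactSpace _ hopen).index_ne_zero
  -- (2) `L ∩ N` has finite index in `N`: it contains the open subgroup `φ(K ∩ Ker aug)` of `N`
  have hLN : L.relIndex N ≠ 0 := by
    haveI : CompactSpace N := isCompact_iff_compactSpace.mp hNcpt
    have hsub : (K ⊓ aug.ker).map φ ≤ L := Subgroup.map_mono inf_le_left
    have hopen : IsOpen ((L.subgroupOf N : Subgroup N) : Set N) := by
      apply Subgroup.isOpen_mono (H₁ := ((K ⊓ aug.ker).map φ).subgroupOf N)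
      · exact fun x hx => Subgroup.mem_subgroupOf.mpr (hsub (Subgroup.mem_subgroupOf.mp hx))
      · rw [Subgroup.coe_subgroupOf]
        exact hgeom.2
    exact (ArithOpenness.finiteIndex_of_isOpen_of_compactSpace _ hopen).index_ne_zero
  -- (3) hence `L` has finite index in `M` and, being closed, is open in `M`
  have hLM : L.relIndex M ≠ 0 := by
    rw [← Subgroup.relIndex_mul_relIndex L S M hLS hSM]
    exact mul_ne_zero (ArithOpenness.relIndex_ne_zero_of_subset_mul hNS hS hLN) hSM'
  haveI : (L.subgroupOf M).FiniteIndex := ⟨hLM⟩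
  have hcl : IsClosed ((L.subgroupOf M : Subgroup M) : Set M) := by
    rw [Subgroup.coe_subgroupOf]
    exact hLcpt.isClosed.preimage continuous_subtype_val
  have hop := Subgroup.isOpen_of_isClosed_of_finiteIndex (L.subgroupOf M) hcl
  rw [Subgroup.coe_subgroupOf] at hop
  exact hop

end Transfer

/-! ### Transport along conjugation -/

namespace ArithOpenness

variable {Gtp : Type u} [Group Gtp] [TopologicalSpace Gtp]
variable {Htp : Type u''} [Group Htp] [TopologicalSpace Htp] [IsTopologicalGroup Htp]

omit [TopologicalSpace Gtp] in
/-- Membership in a conjugate subgroup. [cite: MochizukiSemiAnbd2006, Def 5.3 (iii), p. 65] -/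
theorem mem_conjSubgroup_iff {G : Type*} [Group G] (g : G) (K : Subgroup G) (z : G) :
    z ∈ conjSubgroup g K ↔ g⁻¹ * z * g ∈ K := by
  unfold conjSubgroup
  rw [Subgroup.mem_map_equiv, MulAut.conj_symm_apply]

omit [TopologicalSpace Gtp] in
/-- Conjugating twice. [cite: MochizukiSemiAnbd2006, Def 5.3 (iii), p. 65] -/
theorem conjSubgroup_mul {G : Type*} [Group G] (a b : G) (K : Subgroup G) :
    conjSubgroup (a * b) K = conjSubgroup a (conjSubgroup b K) := by
  ext z
  simp only [mem_conjSubgroup_iff, mul_inv_rev, mul_assoc]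

omit [TopologicalSpace Gtp] in
/-- Conjugation is monotone. [cite: MochizukiSemiAnbd2006, Def 5.3 (iii), p. 65] -/
theorem conjSubgroup_mono {G : Type*} [Group G] (g : G) {K K' : Subgroup G} (h : K ≤ K') :
    conjSubgroup g K ≤ conjSubgroup g K' :=
  Subgroup.map_mono h

omit [TopologicalSpace Gtp] in
/-- Conjugation commutes with intersecting a normal subgroup. [cite: MochizukiSemiAnbd2006, Def 5.3 (iii), p. 65] -/
theorem conjSubgroup_inf_normal {G : Type*} [Group G] (g : G) (K N : Subgroup G) [hN : N.Normal] :
    conjSubgroup g (K ⊓ N) = conjSubgroup g K ⊓ N := by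
  ext z
  simp only [mem_conjSubgroup_iff, Subgroup.mem_inf, and_congr_right_iff]
  intro _
  constructor
  · intro h
    have := hN.conj_mem _ h g
    simpa [mul_assoc] using this
  · intro h
    have := hN.conj_mem _ h g⁻¹
    simpa [mul_assoc] using this

omit [TopologicalSpace Gtp] [TopologicalSpace Htp] [IsTopologicalGroup Htp] in
/-- A homomorphism carries conjugates to conjugates: `φ(x K x⁻¹) = φ(x) φ(K) φ(x)⁻¹`.
[cite: MochizukiSemiAnbd2006, Thm 5.4 (iii), p. 66] -/
theorem map_conjSubgroup (φ : Gtp →* Htp) (x : Gtp) (K : Subgroup Gtp) :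
    (conjSubgroup x K).map φ = conjSubgroup (φ x) (K.map φ) := by
  apply le_antisymm
  · rintro _ ⟨z, hz, rfl⟩
    have hz' : x⁻¹ * z * x ∈ K := (mem_conjSubgroup_iff x K z).mp hz
    rw [mem_conjSubgroup_iff, ← map_inv, ← map_mul, ← map_mul]
    exact ⟨_, hz', rfl⟩
  · intro z hz
    obtain ⟨k, hk, hkz⟩ := (mem_conjSubgroup_iff (φ x) (K.map φ) z).mp hz
    refine ⟨x * k * x⁻¹, (mem_conjSubgroup_iff x K _).mpr (by simpa [mul_assoc] using hk), ?_⟩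
    rw [map_mul, map_mul, map_inv, hkz]
    group

omit [TopologicalSpace Gtp] in
/-- "Maps onto an open subgroup of" is transported along conjugation (conjugation by `φ(x)` is a
homeomorphism of `Π^temp_ℍ`). [cite: MochizukiSemiAnbd2006, Thm 5.4 (iii), p. 66] -/
theorem mapsOntoOpenSubgroupOf_conj {φ : Gtp →* Htp} {A : Subgroup Gtp} {C : Subgroup Htp}
    (h : MapsOntoOpenSubgroupOf φ A C) (x : Gtp) :
    MapsOntoOpenSubgroupOf φ (conjSubgroup x A) (conjSubgroup (φ x) C) := by
  obtain ⟨hle, hop⟩ := h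
  refine ⟨?_, ?_⟩
  · rw [map_conjSubgroup]
    exact conjSubgroup_mono _ hle
  · -- openness in the subspace topology: `C ∩ U = C ∩ φ(A)` for an open `U`; conjugate `U`.
    rw [isOpen_induced_iff] at hop ⊢
    obtain ⟨U, hU, hUeq⟩ := hop
    let y : Htp := φ x
    refine ⟨(fun z => y⁻¹ * z * y) ⁻¹' U, hU.preimage (by fun_prop), ?_⟩
    ext ⟨z, hz⟩
    have hz' : y⁻¹ * z * y ∈ C := (mem_conjSubgroup_iff y C z).mp hz
    have key := congrArg (fun s : Set C => (⟨y⁻¹ * z * y, hz'⟩ : C) ∈ s) hUeq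
    simp only [Set.mem_preimage, SetLike.mem_coe, eq_iff_iff] at key
    simp only [Set.mem_preimage, SetLike.mem_coe]
    rw [key, map_conjSubgroup, mem_conjSubgroup_iff]

end ArithOpenness

/-! ### Theorem 5.4 (iii), clause 1: the hypotheses `hV`, `hE` of `isArithQuasiGeometric_of_statementII` -/

section Clause1

variable {Gtp : Type u} [Group Gtp] [TopologicalSpace Gtp]
variable {Htp : Type u''} [Group Htp] [TopologicalSpace Htp] [IsTopologicalGroup Htp] [T2Space Htp]
variable {PA : Type u'} [Group PA] [TopologicalSpace PA] [T1Space PA]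
variable {V : Type w} {B : Type w'} {V' : Type*} {B' : Type*}
variable {D : DecompositionData Gtp V B} {D' : DecompositionData Htp V' B'}
variable {aug : Gtp →* PA} {aug' : Htp →* PA} {φ : Gtp →* Htp}

/-- **Thm 5.4 (iii), clause 1, verticial part** ("maps any arithmetically maximal compact subgroup
`K₁ ⊆ Π^temp_𝔊` to an open subgroup of some arithmetically maximal compact subgroup `K₂ ⊆ Π^temp_ℍ`",
p. 66, read through Thm 5.4 (ii): maximal compact = verticial): for a continuous `φ` over `Π_A`, given
Remark 5.3.1 (first sentence) on both sides and, for each vertex `v`, a conjugator `g` with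
`φ(Π^temp_{𝔊,v}) ⊆ g Π^temp_{ℍ,f v} g⁻¹` and geometric openness inside (the output of the construction
of the induced morphism of temperoids, Prop 5.2 (iv) / §3), EVERY verticial subgroup of `Π^temp_𝔊` is
mapped onto an open subgroup of a verticial subgroup of `Π^temp_ℍ`.
[cite: MochizukiSemiAnbd2006, Thm 5.4 (iii), p. 66] -/
theorem hV_of_compat (haug' : Continuous aug') (hφ : Continuous φ)
    (hcomp : aug'.comp φ = aug) (hG : VerticialEdgeLikeCompactAmpleStatement D aug)
    (hH : VerticialEdgeLikeCompactAmpleStatement D' aug') (f : V → V')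
    (hv : ∀ v : V, ∃ g : Htp, (D.vertGp v).map φ ≤ conjSubgroup g (D'.vertGp (f v)) ∧
      MapsOntoOpenSubgroupOf φ (D.vertGp v ⊓ aug.ker) (conjSubgroup g (D'.vertGp (f v)) ⊓ aug'.ker)) :
    ∀ K₁ : Subgroup Gtp, IsVerticial D K₁ →
      ∃ K₂ : Subgroup Htp, IsVerticial D' K₂ ∧ MapsOntoOpenSubgroupOf φ K₁ K₂ := by
  rintro K₁ ⟨v, x, rfl⟩
  obtain ⟨g, hle, hgeom⟩ := hv v
  refine ⟨conjSubgroup (φ x * g) (D'.vertGp (f v)), ⟨f v, φ x * g, rfl⟩, ?_⟩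
  have hK₁ := hG (conjSubgroup x (D.vertGp v)) (Or.inl ⟨v, x, rfl⟩)
  have hK₂ := hH (conjSubgroup (φ x * g) (D'.vertGp (f v))) (Or.inl ⟨f v, φ x * g, rfl⟩)
  refine mapsOntoOpen_of_geomOpen haug' hφ hcomp hK₁.1 hK₂.1 ?_ hK₁.2 ?_
  · rw [ArithOpenness.map_conjSubgroup, ArithOpenness.conjSubgroup_mul]
    exact ArithOpenness.conjSubgroup_mono _ hle
  · have h := ArithOpenness.mapsOntoOpenSubgroupOf_conj hgeom x
    rwa [ArithOpenness.conjSubgroup_inf_normal, ArithOpenness.conjSubgroup_inf_normal,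
      ← ArithOpenness.conjSubgroup_mul] at h

/-- **Thm 5.4 (iii), clause 1, edge-like part** ("respectively, arithmetically ample intersection
`K₁ ∩ H₁` … to an open subgroup of some arithmetically ample intersection `K₂ ∩ H₂`", p. 66, read through
Thm 5.4 (ii): ample intersections of distinct maximal compact subgroups = edge-like subgroups): the
same transfer for the decomposition groups of branches. [cite: MochizukiSemiAnbd2006, Thm 5.4 (iii), p. 66] -/
theorem hE_of_compat (haug' : Continuous aug') (hφ : Continuous φ)
    (hcomp : aug'.comp φ = aug) (hG : VerticialEdgeLikeCompactAmpleStatement D aug)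
    (hH : VerticialEdgeLikeCompactAmpleStatement D' aug') (fb : B → B')
    (hb : ∀ b : B, ∃ g : Htp, (D.brGp b).map φ ≤ conjSubgroup g (D'.brGp (fb b)) ∧
      MapsOntoOpenSubgroupOf φ (D.brGp b ⊓ aug.ker) (conjSubgroup g (D'.brGp (fb b)) ⊓ aug'.ker)) :
    ∀ K₁ : Subgroup Gtp, IsEdgeLike D K₁ →
      ∃ K₂ : Subgroup Htp, IsEdgeLike D' K₂ ∧ MapsOntoOpenSubgroupOf φ K₁ K₂ := by
  rintro K₁ ⟨b, x, rfl⟩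
  obtain ⟨g, hle, hgeom⟩ := hb b
  refine ⟨conjSubgroup (φ x * g) (D'.brGp (fb b)), ⟨fb b, φ x * g, rfl⟩, ?_⟩
  have hK₁ := hG (conjSubgroup x (D.brGp b)) (Or.inr ⟨b, x, rfl⟩)
  have hK₂ := hH (conjSubgroup (φ x * g) (D'.brGp (fb b))) (Or.inr ⟨fb b, φ x * g, rfl⟩)
  refine mapsOntoOpen_of_geomOpen haug' hφ hcomp hK₁.1 hK₂.1 ?_ hK₁.2 ?_
  · rw [ArithOpenness.map_conjSubgroup, ArithOpenness.conjSubgroup_mul]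
    exact ArithOpenness.conjSubgroup_mono _ hle
  · have h := ArithOpenness.mapsOntoOpenSubgroupOf_conj hgeom x
    rwa [ArithOpenness.conjSubgroup_inf_normal, ArithOpenness.conjSubgroup_inf_normal,
      ← ArithOpenness.conjSubgroup_mul] at h

end Clause1

end Literature.AnabelianGeometry.SemiGraphs
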